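import Mathlib.Analysis.InnerProductSpace.Projection.Reflection
import Mathlib.MeasureTheory.Measure.Regular
import Mathlib.Topology.MetricSpace.Thickening
import Literature.Analysis.FunctionSpaces.TorusPatching
import Literature.Analysis.FluidPDE.StationaryEulerPotentials
import HarnessLib

/-!
# Aligned cubes: Householder frames, grids of rotated cubes, filling an open set
(Choffrut–Székelyhidi 2014, Lemma 4 / Prop. 6: "rescaled and translated copies on the cube")

Topic `Literature/Analysis/FluidPDE`. Support file of the proof of
`Literature.Analysis.FluidPDE.Torus.ChoffrutSzekelyhidi2014_thm1` (Choffrut–Székelyhidi, SIAM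
J. Math. Anal. 46 (2014) = arXiv:1401.4301). The two-state oscillation of Lemma 4 is placed on
cubes *aligned with the oscillation direction* `η` (so that its level sets are exact unions of
slabs), and the induction of Prop. 6 and the covering step of the iteration fill open sets by
finitely many such cubes. This file provides the elementary geometry:

* `houseR i₀ η`: the Householder reflection exchanging the unit vector `η` and the coordinate
  vector `e_{i₀}` (Mathlib's `reflection`), a linear isometry with `⟪η, x⟫ = (houseR i₀ η x)_{i₀}`;
* the open unit box `box`, and for a linear isometry `R` the reference cube `refCube R = R⁻¹ box`
  and the grid of open aligned cubes `acube R m κ = R⁻¹ (κ/m + m⁻¹ box)` (`κ ∈ ℤ^d`), their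
  corners, volumes (`m^{-d}`), disjointness, and the rescaling identities
  `acube R m κ = corner + m⁻¹ • refCube R`;
* **filling** (`exists_acubes_subset`): an open set of finite measure contains, for every
  `ε > 0` and every `m₀`, finitely many grid cubes of some mesh `m⁻¹ < m₀⁻¹` whose closures lie
  in the set and which exhaust it up to measure `ε` (inner regularity by a compact set, a
  thickening margin, and the cubes of a fine grid meeting the compact set).

## References

* A. Choffrut, L. Székelyhidi Jr., SIAM J. Math. Anal. 46 (2014), Lemma 4, Prop. 6, §2 Step 3.
-/

noncomputable section

open scoped InnerProductSpace ENNReal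
open Set Function MeasureTheory Metric
open Literature.Analysis.FunctionSpaces

namespace Literature.Analysis.FluidPDE

namespace StationaryEuler

variable {d : Type*} [Fintype d] [DecidableEq d]

/-! ## Householder frames -/

omit [Fintype d] in
/-- `‖e_i‖ = 1`. [folklore] -/
theorem norm_eb [Fintype d] (i : d) : ‖(eb i : Ed d)‖ = 1 := by
  rw [eb, EuclideanSpace.single, PiLp.norm_single, norm_one]

/-- The Householder reflection exchanging the unit vector `η` with `e_{i₀}` (the reflection in
the hyperplane orthogonal to `η - e_{i₀}`; the identity if `η = e_{i₀}`). [folklore] -/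
def houseR (i₀ : d) (η : Ed d) : Ed d ≃ₗᵢ[ℝ] Ed d := Submodule.reflection (ℝ ∙ (η - eb i₀))ᗮ

/-- `houseR` maps `η` to `e_{i₀}` (for a unit vector `η`). [folklore] -/
theorem houseR_apply_self (i₀ : d) {η : Ed d} (hη : ‖η‖ = 1) : houseR i₀ η η = eb i₀ :=
  Submodule.reflection_sub (by rw [hη, norm_eb])

/-- **The phase in the Householder frame**: `⟪η, x⟫ = (houseR i₀ η x)_{i₀}`. [folklore] -/
theorem inner_eq_houseR_apply (i₀ : d) {η : Ed d} (hη : ‖η‖ = 1) (x : Ed d) :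
    ⟪η, x⟫_ℝ = houseR i₀ η x i₀ := by
  rw [← (houseR i₀ η).inner_map_map η x, houseR_apply_self i₀ hη, eb,
    EuclideanSpace.inner_single_left]
  simp

/-! ## Boxes and aligned cubes -/

variable (d) in
/-- The open unit box `(0,1)^d`. [folklore] -/
def box : Set (Ed d) := {y | ∀ i, y i ∈ Ioo (0 : ℝ) 1}

omit [Fintype d] [DecidableEq d] in
/-- Membership in the box. [folklore] -/
@[simp] theorem mem_box {y : Ed d} : y ∈ box d ↔ ∀ i, y i ∈ Ioo (0 : ℝ) 1 := Iff.rfl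

omit [Fintype d] [DecidableEq d] in
/-- The box is the open lattice cell of mesh `1` at `0`. [folklore] -/
theorem box_eq_latticeCellInterior : box d = Torus.latticeCellInterior 1 (0 : d → ℤ) := by
  ext y; simp [box, Torus.latticeCellInterior]

omit [DecidableEq d] in
/-- The box is open. [folklore] -/
theorem isOpen_box : IsOpen (box d) := by
  rw [box_eq_latticeCellInterior]; exact Torus.isOpen_latticeCellInterior

omit [DecidableEq d] in
/-- The box has volume `1`. [folklore] -/
theorem volume_box : volume (box d) = 1 := by
  rw [box_eq_latticeCellInterior, Torus.volume_latticeCellInterior Nat.one_pos]; simp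

variable (R : Ed d ≃ₗᵢ[ℝ] Ed d)

/-- The reference cube of the frame `R`: `R⁻¹ (0,1)^d`. [folklore] -/
def refCube : Set (Ed d) := R ⁻¹' box d

omit [DecidableEq d] in
/-- Membership in the reference cube. [folklore] -/
@[simp] theorem mem_refCube {x : Ed d} : x ∈ refCube R ↔ R x ∈ box d := Iff.rfl

omit [DecidableEq d] in
/-- The reference cube is open. [folklore] -/
theorem isOpen_refCube : IsOpen (refCube R) := isOpen_box.preimage R.continuous

omit [DecidableEq d] in
/-- The reference cube has volume `1`. [folklore] -/
theorem volume_refCube : volume (refCube R) = 1 := by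
  rw [refCube, R.measurePreserving.measure_preimage isOpen_box.measurableSet.nullMeasurableSet, volume_box]

omit [DecidableEq d] in
/-- The reference cube is bounded. [folklore] -/
theorem refCube_subset_closedBall : refCube R ⊆ closedBall 0 (Real.sqrt (Fintype.card d)) := by
  intro x hx
  rw [mem_closedBall, dist_zero_right, ← R.norm_map x]
  have h := hx
  rw [mem_refCube, mem_box] at h
  have hsq : ‖R x‖ ^ 2 ≤ Fintype.card d := by
    rw [EuclideanSpace.norm_sq_eq]
    calc ∑ i, ‖R x i‖ ^ 2 ≤ ∑ _i : d, (1 : ℝ) := Finset.sum_le_sum fun i _ => by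
          rw [Real.norm_eq_abs, sq_abs]
          have := h i; nlinarith [this.1, this.2]
      _ = Fintype.card d := by simp
  exact Real.le_sqrt_of_sq_le hsq

/-- The open aligned cube of mesh `m⁻¹` with index `κ`: `R⁻¹` of the open lattice cell. [folklore] -/
def acube (m : ℕ) (κ : d → ℤ) : Set (Ed d) := R ⁻¹' Torus.latticeCellInterior m κ

/-- The closed aligned cube. [folklore] -/
def acubeClosed (m : ℕ) (κ : d → ℤ) : Set (Ed d) :=
  R ⁻¹' {y | ∀ i, y i ∈ Icc ((κ i : ℝ) / m) ((κ i + 1 : ℝ) / m)}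

/-- The corner `R⁻¹(κ/m)` of an aligned cube. [folklore] -/
def corner (m : ℕ) (κ : d → ℤ) : Ed d := R.symm (WithLp.toLp 2 fun i => (κ i : ℝ) / m)

variable {R}

omit [DecidableEq d] in
/-- Membership in an aligned cube. [folklore] -/
theorem mem_acube {m : ℕ} {κ : d → ℤ} {x : Ed d} :
    x ∈ acube R m κ ↔ ∀ i, R x i ∈ Ioo ((κ i : ℝ) / m) ((κ i + 1 : ℝ) / m) := Iff.rfl

omit [DecidableEq d] in
/-- Membership in a closed aligned cube. [folklore] -/
theorem mem_acubeClosed {m : ℕ} {κ : d → ℤ} {x : Ed d} :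
    x ∈ acubeClosed R m κ ↔ ∀ i, R x i ∈ Icc ((κ i : ℝ) / m) ((κ i + 1 : ℝ) / m) := Iff.rfl

omit [DecidableEq d] in
/-- Aligned cubes are open. [folklore] -/
theorem isOpen_acube (m : ℕ) (κ : d → ℤ) : IsOpen (acube R m κ) :=
  Torus.isOpen_latticeCellInterior.preimage R.continuous

omit [DecidableEq d] in
/-- Aligned cubes are measurable. [folklore] -/
theorem measurableSet_acube (m : ℕ) (κ : d → ℤ) : MeasurableSet (acube R m κ) :=
  (isOpen_acube m κ).measurableSet

omit [DecidableEq d] in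
/-- The open cube lies in the closed cube. [folklore] -/
theorem acube_subset_acubeClosed (m : ℕ) (κ : d → ℤ) : acube R m κ ⊆ acubeClosed R m κ :=
  fun _ hx i => Ioo_subset_Icc_self (hx i)

omit [DecidableEq d] in
/-- Volume of an aligned cube: `m^{-d}`. [folklore] -/
theorem volume_acube {m : ℕ} (hm : 0 < m) (κ : d → ℤ) :
    volume (acube R m κ) = ENNReal.ofReal ((m : ℝ)⁻¹) ^ Fintype.card d := by
  rw [acube, R.measurePreserving.measure_preimage
    Torus.isOpen_latticeCellInterior.measurableSet.nullMeasurableSet, Torus.volume_latticeCellInterior hm]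

omit [DecidableEq d] in
/-- Real volume of an aligned cube. [folklore] -/
theorem volume_real_acube {m : ℕ} (hm : 0 < m) (κ : d → ℤ) :
    volume.real (acube R m κ) = ((m : ℝ)⁻¹) ^ Fintype.card d := by
  rw [Measure.real, volume_acube hm, ENNReal.toReal_pow, ENNReal.toReal_ofReal (by positivity)]

omit [DecidableEq d] in
/-- Volume of a closed aligned cube: also `m^{-d}`. [folklore] -/
theorem volume_acubeClosed {m : ℕ} (hm : 0 < m) (κ : d → ℤ) :
    volume (acubeClosed R m κ) = ENNReal.ofReal ((m : ℝ)⁻¹) ^ Fintype.card d := by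
  have hpre : {y : Ed d | ∀ i, y i ∈ Icc ((κ i : ℝ) / m) ((κ i + 1 : ℝ) / m)} =
      WithLp.ofLp ⁻¹' Icc (fun i => (κ i : ℝ) / m) (fun i => (κ i + 1 : ℝ) / m) := by
    ext y; simp [Pi.le_def, mem_Icc, forall_and]
  have hmeas : MeasurableSet {y : Ed d | ∀ i, y i ∈ Icc ((κ i : ℝ) / m) ((κ i + 1 : ℝ) / m)} := by
    rw [hpre]; exact measurableSet_Icc.preimage (WithLp.measurable_ofLp 2 _)
  rw [acubeClosed, R.measurePreserving.measure_preimage hmeas.nullMeasurableSet, hpre,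
    (PiLp.volume_preserving_ofLp d).measure_preimage measurableSet_Icc.nullMeasurableSet, Real.volume_Icc_pi]
  have h : ∀ i, ((κ i : ℝ) + 1) / m - (κ i : ℝ) / m = (m : ℝ)⁻¹ := fun i => by
    have hm' : (m : ℝ) ≠ 0 := by exact_mod_cast hm.ne'
    field_simp; ring
  simp only [h, Finset.prod_const, Finset.card_univ]

omit [DecidableEq d] in
/-- The boundary of an aligned cube is null. [folklore] -/
theorem volume_acubeClosed_diff {m : ℕ} (hm : 0 < m) (κ : d → ℤ) :
    volume (acubeClosed R m κ \ acube R m κ) = 0 := by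
  rw [measure_sdiff (acube_subset_acubeClosed m κ) (measurableSet_acube m κ).nullMeasurableSet
    (by rw [volume_acube hm]; exact ENNReal.pow_ne_top ENNReal.ofReal_ne_top),
    volume_acubeClosed hm, volume_acube hm, tsub_self]

omit [DecidableEq d] in
/-- Distinct aligned cubes of the same grid are disjoint. [folklore] -/
theorem disjoint_acube {m : ℕ} (hm : 0 < m) {κ κ' : d → ℤ} (h : κ ≠ κ') :
    Disjoint (acube R m κ) (acube R m κ') :=
  ((Torus.disjoint_latticeCell hm h).mono Torus.latticeCellInterior_subset
    Torus.latticeCellInterior_subset).preimage R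

omit [DecidableEq d] in
/-- Coordinates of the corner in the frame. [folklore] -/
@[simp] theorem R_corner_apply (m : ℕ) (κ : d → ℤ) (i : d) : R (corner R m κ) i = (κ i : ℝ) / m := by
  simp [corner]

omit [DecidableEq d] in
/-- **Aligned cubes are rescaled reference cubes**:
`x ∈ acube R m κ ↔ m • (x - corner) ∈ refCube R`. [folklore] -/
theorem mem_acube_iff_smul_sub_mem {m : ℕ} (hm : 0 < m) {κ : d → ℤ} {x : Ed d} :
    x ∈ acube R m κ ↔ (m : ℝ) • (x - corner R m κ) ∈ refCube R := by
  have hm' : (0 : ℝ) < m := by exact_mod_cast hm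
  rw [mem_acube, mem_refCube, mem_box]
  refine forall_congr' fun i => ?_
  rw [map_smul, map_sub, PiLp.smul_apply, PiLp.sub_apply, R_corner_apply, smul_eq_mul, mem_Ioo,
    mem_Ioo, div_lt_iff₀ hm', lt_div_iff₀ hm', mul_sub, mul_div_cancel₀ _ hm'.ne']
  constructor <;> rintro ⟨h1, h2⟩ <;> constructor <;> nlinarith

omit [DecidableEq d] in
/-- The same with the inverse mesh as scale factor. [folklore] -/
theorem mem_acube_iff_inv_smul {m : ℕ} (hm : 0 < m) {κ : d → ℤ} {x : Ed d} :
    x ∈ acube R m κ ↔ ((m : ℝ)⁻¹)⁻¹ • (x - corner R m κ) ∈ refCube R := by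
  rw [inv_inv]; exact mem_acube_iff_smul_sub_mem hm

omit [DecidableEq d] in
/-- Aligned cubes as images of the reference cube under `y ↦ corner + m⁻¹ y`. [folklore] -/
theorem acube_eq_image {m : ℕ} (hm : 0 < m) (κ : d → ℤ) :
    acube R m κ = (fun y => corner R m κ + (m : ℝ)⁻¹ • y) '' refCube R := by
  have hm' : (m : ℝ) ≠ 0 := by exact_mod_cast hm.ne'
  ext x
  rw [mem_acube_iff_smul_sub_mem hm, mem_image]
  constructor
  · intro hx
    exact ⟨(m : ℝ) • (x - corner R m κ), hx, by rw [smul_smul, inv_mul_cancel₀ hm', one_smul]; abel⟩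
  · rintro ⟨y, hy, rfl⟩
    simpa [smul_smul, mul_inv_cancel₀ hm'] using hy

omit [DecidableEq d] in
/-- Two points of a closed aligned cube are at distance `≤ √d/m`. [folklore] -/
theorem dist_le_of_mem_acubeClosed {m : ℕ} (hm : 0 < m) {κ : d → ℤ} {x z : Ed d}
    (hx : x ∈ acubeClosed R m κ) (hz : z ∈ acubeClosed R m κ) :
    dist x z ≤ Real.sqrt (Fintype.card d) / m := by
  have hm' : (0 : ℝ) < m := by exact_mod_cast hm
  rw [dist_eq_norm, ← R.norm_map, map_sub]
  have hcoord : ∀ i, (R x - R z) i ^ 2 ≤ ((m : ℝ)⁻¹) ^ 2 := by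
    intro i
    have h1 := hx i
    have h2 := hz i
    rw [mem_Icc] at h1 h2
    have hlen : ((κ i : ℝ) + 1) / m - (κ i : ℝ) / m = (m : ℝ)⁻¹ := by field_simp; ring
    have : |(R x - R z) i| ≤ (m : ℝ)⁻¹ := by
      rw [PiLp.sub_apply, abs_le]; constructor <;> linarith
    exact sq_le_sq' (abs_le.1 this).1 (abs_le.1 this).2
  have hsq : ‖R x - R z‖ ^ 2 ≤ (Real.sqrt (Fintype.card d) / m) ^ 2 := by
    rw [EuclideanSpace.norm_sq_eq, div_pow, Real.sq_sqrt (by positivity)]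
    calc ∑ i, ‖(R x - R z) i‖ ^ 2 ≤ ∑ _i : d, ((m : ℝ)⁻¹) ^ 2 :=
          Finset.sum_le_sum fun i _ => by rw [Real.norm_eq_abs, sq_abs]; exact hcoord i
      _ = Fintype.card d / (m : ℝ) ^ 2 := by simp [Finset.card_univ]; ring
  exact le_of_sq_le_sq hsq (by positivity)

omit [DecidableEq d] in
/-- Every point lies in the closed aligned cube of its index `⌊m R x⌋`. [folklore] -/
theorem mem_acubeClosed_cellIndex {m : ℕ} (hm : 0 < m) (x : Ed d) :
    x ∈ acubeClosed R m (Torus.cellIndex m (R x)) := fun i =>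
  Ico_subset_Icc_self (Torus.mem_latticeCell_cellIndex hm (R x) i)

omit [DecidableEq d] in
/-- The index of the cube containing a point of norm `≤ ρ` is bounded by `m ρ + 1`. [folklore] -/
theorem abs_cellIndex_le {m : ℕ} {x : Ed d} {ρ : ℝ} (hx : ‖x‖ ≤ ρ) (i : d) :
    |(Torus.cellIndex m (R x) i : ℝ)| ≤ m * ρ + 1 := by
  have hRx : |R x i| ≤ ρ := by
    have := PiLp.norm_apply_le (p := 2) (R x) i
    rw [Real.norm_eq_abs, R.norm_map] at this
    exact this.trans hx
  rw [Torus.cellIndex_apply]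
  have h1 := Int.floor_le ((m : ℝ) * R x i)
  have h2 := Int.lt_floor_add_one ((m : ℝ) * R x i)
  have hm : (0 : ℝ) ≤ m := Nat.cast_nonneg m
  have hb : |(m : ℝ) * R x i| ≤ m * ρ := by rw [abs_mul, abs_of_nonneg hm]; exact mul_le_mul_of_nonneg_left hRx hm
  rw [abs_le] at hb ⊢
  constructor <;> linarith [hb.1, hb.2]

/-! ## Filling an open set by aligned cubes -/

/-- **Filling.** An open set `A ⊆ ℝ^d` of finite measure contains, for every `ε > 0` and every
`m₀`, a finite family of grid cubes of the frame `R` of some mesh `m⁻¹`, `m > m₀`, whose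
closures lie in `A` and which cover `A` up to measure `ε` (compact inner approximation,
thickening margin, fine grid). Distinct cubes of the family are disjoint (`disjoint_acube`).
[cite: ChoffrutSzekelyhidi2014, §2, Step 3] -/
theorem exists_acubes_subset {A : Set (Ed d)} (hA : IsOpen A) (hAfin : volume A ≠ ⊤) {ε : ℝ≥0∞}
    (hε : ε ≠ 0) (m₀ : ℕ) :
    ∃ m : ℕ, m₀ < m ∧ ∃ S : Finset (d → ℤ), (∀ κ ∈ S, acubeClosed R m κ ⊆ A) ∧
      volume (A \ ⋃ κ ∈ S, acube R m κ) < ε := by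
  classical
  -- compact inner approximation and a margin
  obtain ⟨K, hKA, hK, hμ⟩ := hA.measurableSet.exists_isCompact_sdiff_lt hAfin hε
  obtain ⟨δ, hδ, hthick⟩ := hK.exists_thickening_subset_open hA hKA
  -- a fine mesh
  obtain ⟨m, hm⟩ := exists_nat_gt (max (m₀ : ℝ) (Real.sqrt (Fintype.card d) / δ))
  have hm₀ : m₀ < m := by exact_mod_cast (le_max_left _ _).trans_lt hm
  have hmpos : 0 < m := lt_of_le_of_lt (Nat.zero_le _) hm₀
  have hm' : (0 : ℝ) < m := by exact_mod_cast hmpos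
  have hdiam : Real.sqrt (Fintype.card d) / m < δ := by
    rw [div_lt_iff₀ hm']
    have := (le_max_right _ _).trans_lt hm
    rw [div_lt_iff₀ hδ] at this
    linarith [mul_comm δ (m : ℝ)]
  -- the finite index window
  obtain ⟨ρ, hρ⟩ := hK.isBounded.subset_closedBall 0
  set N : ℕ := ⌈(m : ℝ) * |ρ| + 1⌉₊ with hN
  set S : Finset (d → ℤ) := (Fintype.piFinset fun _ : d => Finset.Icc (-(N : ℤ)) N).filter
    fun κ => (acubeClosed R m κ ∩ K).Nonempty with hS
  refine ⟨m, hm₀, S, fun κ hκ => ?_, ?_⟩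
  · -- cubes meeting `K` lie in the thickening
    obtain ⟨z, hzQ, hzK⟩ := (Finset.mem_filter.1 hκ).2
    intro x hx
    refine hthick (Metric.mem_thickening_iff.2 ⟨z, hzK, ?_⟩)
    exact (dist_le_of_mem_acubeClosed hmpos hx hzQ).trans_lt hdiam
  · -- `A ∖ ⋃ cubes ⊆ (A ∖ K) ∪ ⋃ (closed ∖ open)`
    have hcover : K ⊆ ⋃ κ ∈ S, acubeClosed R m κ := by
      intro x hxK
      have hxρ : ‖x‖ ≤ |ρ| := by
        have := hρ hxK
        rw [mem_closedBall, dist_zero_right] at this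
        exact this.trans (le_abs_self ρ)
      set κ := Torus.cellIndex m (R x) with hκ
      have hxQ : x ∈ acubeClosed R m κ := mem_acubeClosed_cellIndex hmpos x
      have hκS : κ ∈ S := by
        refine Finset.mem_filter.2 ⟨Fintype.mem_piFinset.2 fun i => Finset.mem_Icc.2 ?_, ⟨x, hxQ, hxK⟩⟩
        have hb := abs_cellIndex_le (R := R) (m := m) hxρ i
        have hN' : (m : ℝ) * |ρ| + 1 ≤ N := Nat.le_ceil _
        have : |(κ i : ℝ)| ≤ N := hb.trans hN'
        rw [abs_le] at this
        exact ⟨by exact_mod_cast this.1, by exact_mod_cast this.2⟩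
      exact mem_iUnion₂.2 ⟨κ, hκS, hxQ⟩
    have hsub : A \ ⋃ κ ∈ S, acube R m κ ⊆ (A \ K) ∪ ⋃ κ ∈ S, (acubeClosed R m κ \ acube R m κ) := by
      intro x hx
      by_cases hxK : x ∈ K
      · obtain ⟨κ, hκS, hxQ⟩ := mem_iUnion₂.1 (hcover hxK)
        refine Or.inr (mem_iUnion₂.2 ⟨κ, hκS, hxQ, fun h => hx.2 (mem_iUnion₂.2 ⟨κ, hκS, h⟩)⟩)
      · exact Or.inl ⟨hx.1, hxK⟩
    have hnull : volume (⋃ κ ∈ S, (acubeClosed R m κ \ acube R m κ)) = 0 :=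
      (measure_biUnion_null_iff S.finite_toSet.countable).2 fun κ _ => volume_acubeClosed_diff hmpos κ
    calc volume (A \ ⋃ κ ∈ S, acube R m κ)
        ≤ volume ((A \ K) ∪ ⋃ κ ∈ S, (acubeClosed R m κ \ acube R m κ)) := measure_mono hsub
      _ ≤ volume (A \ K) + volume (⋃ κ ∈ S, (acubeClosed R m κ \ acube R m κ)) := measure_union_le _ _
      _ = volume (A \ K) := by rw [hnull, add_zero]
      _ < ε := hμ

omit [DecidableEq d] in
/-- The cubes of a filling are pairwise disjoint and their total volume is `#S · m^{-d}`. [folklore] -/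
theorem volume_biUnion_acube {m : ℕ} (hm : 0 < m) (S : Finset (d → ℤ)) :
    volume (⋃ κ ∈ S, acube R m κ) = S.card * ENNReal.ofReal ((m : ℝ)⁻¹) ^ Fintype.card d := by
  classical
  rw [measure_biUnion_finset (fun κ _ κ' _ h => disjoint_acube hm h) fun κ _ => measurableSet_acube m κ]
  simp [volume_acube hm, Finset.sum_const]

end StationaryEuler

end Literature.Analysis.FluidPDE
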